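import Summits.ResolutionOfSingularities.ResolutionOfSingularities.Theorems.PurelyInseparableDim4SwapTransportWindowWeightsSigma
import Summits.ResolutionOfSingularities.ResolutionOfSingularities.Theorems.PurelyInseparableDim4ResConeCInfWindowToolsPrime
import HarnessLib
import HarnessLib.Audit.Tags

/-!
# Purely inseparable four-folds — WINDOW FRAME FOR EVERY σ = (n, n) + 0: the straight twin-slot frame with its jet (slot ledger, dead
# row, row flag) survives a PURE slot step, and the virtual translation vanishes in such a frame (cell `res-dim4-pi`, K2(p) lane,
# B-LF (iii-b) class (iii), virtual port 1 ↦ n of the C∞ window, FILE F1 = W3 p714641 with `1 ↦ n`)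

[OURS · counted 0 · cell `res-dim4-pi` · K2(p) lane (holder res-dim4-p-12 g5, ruling g5-21 (α)).]  Nothing here proves K2(p) for any `p`, any
TAIL(p, d, 3), `NoIsolatedTrap p p` or resolution of singularities in dimension ≥ 4 / characteristic `p` — NOT proved.  AI kernel work,
weaker than expert review.  Bookkeeping about ONE pure step of OUR frame; kills nothing by itself.

THE FRAME at weights `(n, n) + 0` (slots `λ, μ`, free `u, f`; order `p + n`, `n + d = p`): `x^r ∣ F`, `resForm = a·x_f^d`, SLOT LEDGER
`e_f ≤ d − 1 ⇒ e_λ, e_μ ≥ n + 1`, DEAD ROW `(e_u, e_f) ≠ (eu, ef)` below degree `N` (`eu + ef = d − 2`), ROW FLAG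
`coeff (r + λ + μ + (eu+1)·u + ef·f) ≠ 0`.
* §1 readings: `degree_succ_le_of_straight_sigma0` (`e_f ≤ d − 1 ⇒ |e| ≥ p + n + 1`), `tsch_row_of_ledger_sigma0` (the Tschirnhaus row
  vanishes by the slot ledger), `row_step_zero_sigma0` (the dead row passes to the pure slot child below `N − d`: res-dim4-p-3's
  `row_step_zero_prime` with `1 ↦ n`), `coeff_rowFlag_step_zero_sigma0` (the flag exponent — degree `p + n + 1`, chart entry `n + 1` — is
  fixed by the chart law and is no `p`-th power).
* §2 **`translation_eq_zero_of_frame_sigma0`** — a `Step p` in the chart of `λ` with translation off the slots whose child has order `p + n`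
  and `e_G = 3` has `b′ = 0`: `f`-component by σ-(VT-f) (`ResCone.translation_contact_eq_zero_sigma_of_eq`, W2σ p719289), `u`-component by
  the two-state pinning `hVTu` taken BY VALUE (P1 `ResCone.cInf_translation_u_eq_zero_sigma0` supplies it from the dead row + flag).
* §3 **`frame_step_zero_sigma0`** — the frame passes to the PURE slot child given the child's order and `e_G = 3`: straightness by
  res-dim4-p-7's `ResCone.twoSlot_legal_readings_of_corner_sigma` (w = 0), ledger by res-dim4-p-1's `ResCone.ledger_step_zero_sigma`, row and
  flag by §1.
[cite: CossartJannsenSaito2020, Thm. 3.14, Lemma 13.2] [cite: Hauser2010, §§F–G] [cite: HauserPerlega2019PRIMS, §2]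
bears_on: LADDER-RESOLUTION:D157-DOOR2 (res-dim4-pi · K2(p) B-LF (iii-b) class (iii) virtual port F1).  Supports
stmt-ResolutionOfSingularities-16155 (helper).
-/

set_option linter.dupNamespace false -- mandated namespace of this single-conjunct summit

noncomputable section

namespace Summit.ResolutionOfSingularities.ResolutionOfSingularities.Theorems.PIDim4

namespace SwapTransport

open MvPolynomial Finset
open Literature.AlgebraicGeometry.Resolution
open Literature.AlgebraicGeometry.Resolution.CentreBlowup
open Literature.AlgebraicGeometry.Resolution.Hauser2010
open Literature.AlgebraicGeometry.Resolution.HauserPerlega2019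

variable {K : Type} [Field K] [DecidableEq K]

/-! ## §0 σ-(VT-f), FREE EDITION: the translation may move letters outside the boundary monomial (W2σ p719289 with `hb : r i ≠ 0 → b i = 0`) -/

omit [DecidableEq K] in
/-- Hauser's shear of the straight initial monomial with an arbitrary boundary monomial: `shear_κ^b (a·x^r·x_f^d) = a·x^r·(x_f + b_f x_κ)^d`
when `b` vanishes on the letters of `x^r` (free letters outside `x^r·x_f^d` may move: they do not occur).
[cite: Hauser2010, §I (definition of P⁺)] -/
theorem shear_monomial_contact_pow_free {κ f : Fin 4} (hκf : κ ≠ f) {r : Fin 4 →₀ ℕ} {b : Fin 4 → K}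
    (hb : ∀ i, r i ≠ 0 → b i = 0) (a : K) (d : ℕ) :
    shear κ b (monomial (r + Finsupp.single f d) a) = monomial r a * (X f + C (b f) * X κ) ^ d := by
  classical
  -- the shear fixes `x^r` (no `x_f` in it, and `b` vanishes on the letters of `r`)
  have hr : aeval (fun i => if i = κ then X κ else X i + C (b i) * X κ) (monomial r (1 : K)) = monomial r 1 := by
    rw [aeval_monomial, algebraMap_eq, monomial_eq]
    congr 1
    rw [Finsupp.prod, Finsupp.prod]
    refine Finset.prod_congr rfl fun i hi => ?_
    by_cases hiκ : i = κ
    · rw [hiκ, if_pos rfl]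
    · rw [if_neg hiκ, hb i (Finsupp.mem_support_iff.mp hi), C_0, zero_mul, add_zero]
  have hsplit : (monomial (r + Finsupp.single f d) a : MvPolynomial (Fin 4) K) = C a * monomial r 1 * X f ^ d := by
    rw [X_pow_eq_monomial, C_mul_monomial, mul_one, monomial_mul, mul_one]
  rw [hsplit]
  unfold shear
  rw [map_mul, map_mul, map_pow, aeval_C, algebraMap_eq, aeval_X, if_neg hκf.symm, hr, C_mul_monomial, mul_one]

/-- **The reading at `x^r` of the child, every σ.**  For a state of order `|r| + d` with straight contact initial form `in F = a·x^r·x_f^d`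
(`r_f = 0`, `0 < r_κ = n < p`, `|r| + d = p + n`), the `Step p` in the boundary chart `κ` with a translation supported on `f` has
`coeff_{x^r} F′ = a · b_f^d`.
[OURS] [cite: Hauser2010, §§F, I] -/
theorem coeff_step_at_weights_sigma_free (p : ℕ) {d n : ℕ} (hn : 0 < n) (hnp : n < p) {r : Fin 4 →₀ ℕ} {κ f : Fin 4}
    (hκf : κ ≠ f) (hrf : r f = 0) (hrκ : r κ = n) (hord : r.degree + d = p + n) {s : State K}
    (ho : ordZero s.F = ((p + n : ℕ) : ℕ∞)) {a : K} (hin : initialForm s.F = monomial (r + Finsupp.single f d) a)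
    {b : Fin 4 → K} (hb : ∀ i, r i ≠ 0 → b i = 0) :
    coeff r (CentreBlowup.step p Finset.univ κ b s).F = a * b f ^ d := by
  have hbκ : b κ = 0 := hb κ (by rw [hrκ]; omega)
  have hq : ((p : ℕ) : ℕ∞) ≤ ordAlong Finset.univ s.F := by
    rw [ordAlong_univ, ho]; exact_mod_cast Nat.le_add_right p n
  -- the chart preimage of `x^r` is `x^r x_κ^d`, of degree `|r| + d = p + n`
  have hdeg : (r + Finsupp.single κ d : Fin 4 →₀ ℕ).degree = p + n := by
    rw [map_add, Finsupp.degree_single, hord]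
  have hce : chartExponent p Finset.univ κ (r + Finsupp.single κ d) = r := by
    apply Finsupp.ext
    intro i
    by_cases hi : i = κ
    · subst hi
      rw [chartExponent, degIn_univ, hdeg, Finsupp.coe_update, Function.update_self]
      omega
    · rw [chartExponent_apply_of_ne p Finset.univ hi, Finsupp.add_apply, Finsupp.single_eq_of_ne hi, add_zero]
  have hnp' : ¬ IsPthPowerExponent p (chartExponent p Finset.univ κ (r + Finsupp.single κ d)) := by
    rw [hce]
    refine ResCone.not_isPthPowerExponent_of_not_dvd (i := κ) ?_
    rw [hrκ]
    exact Nat.not_dvd_of_pos_of_lt hn hnp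
  have h := ResCone.coeff_step_F_chartExponent p κ hbκ s hq (e := r + Finsupp.single κ d) (by rw [hdeg]; omega)
  rw [if_neg hnp', hce, ResCone.coeff_shear_eq_coeff_shear_initialForm_of_degree_eq κ b ho hdeg, hin,
    shear_monomial_contact_pow_free hκf hb, ResCone.coeff_monomial_mul_contact_shear_pow hκf hrf] at h
  exact h

/-- **(VT-f) FOR EVERY WEIGHT VECTOR σ**: in the setting of `coeff_step_at_weights_sigma` with `a ≠ 0` and `1 ≤ d`, if the child has
order `> |r|` (in a σ-tail: order `p + n` again) then the form-carrying letter was NOT translated: `b_f = 0` (otherwise the child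
contains `a b_f^d · x^r`, of degree `|r|`). [OURS] [cite: CossartJannsenSaito2020, Thm. 3.14] -/
theorem translation_contact_eq_zero_sigma_free (p : ℕ) {d n : ℕ} (hd1 : 1 ≤ d) (hn : 0 < n) (hnp : n < p) {r : Fin 4 →₀ ℕ}
    {κ f : Fin 4} (hκf : κ ≠ f) (hrf : r f = 0) (hrκ : r κ = n) (hord : r.degree + d = p + n) {s : State K}
    (ho : ordZero s.F = ((p + n : ℕ) : ℕ∞)) {a : K} (ha : a ≠ 0)
    (hin : initialForm s.F = monomial (r + Finsupp.single f d) a) {b : Fin 4 → K} (hb : ∀ i, r i ≠ 0 → b i = 0)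
    (ho' : ((r.degree + 1 : ℕ) : ℕ∞) ≤ ordZero (CentreBlowup.step p Finset.univ κ b s).F) : b f = 0 := by
  have h := coeff_step_at_weights_sigma_free p hn hnp hκf hrf hrκ hord ho hin hb
  have h0 : coeff r (CentreBlowup.step p Finset.univ κ b s).F = 0 := by
    apply coeff_eq_zero_of_degree_lt_ordZero
    refine lt_of_lt_of_le ?_ ho'
    exact_mod_cast Nat.lt_succ_self _
  rw [h0] at h
  have hpow : b f ^ d = 0 := by
    rcases mul_eq_zero.mp h.symm with h1 | h1
    · exact absurd h1 ha
    · exact h1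
  exact pow_eq_zero_iff (by omega) |>.mp hpow

/-- The σ-tail form of `translation_contact_eq_zero_sigma`: the child has order `p + n` again. [OURS] -/
theorem translation_contact_eq_zero_sigma_free_of_eq (p : ℕ) {d n : ℕ} (hd1 : 1 ≤ d) (hn : 0 < n) (hnp : n < p)
    {r : Fin 4 →₀ ℕ} {κ f : Fin 4} (hκf : κ ≠ f) (hrf : r f = 0) (hrκ : r κ = n) (hord : r.degree + d = p + n)
    {s : State K} (ho : ordZero s.F = ((p + n : ℕ) : ℕ∞)) {a : K} (ha : a ≠ 0)
    (hin : initialForm s.F = monomial (r + Finsupp.single f d) a) {b : Fin 4 → K} (hb : ∀ i, r i ≠ 0 → b i = 0)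
    (ho' : ordZero (CentreBlowup.step p Finset.univ κ b s).F = ((p + n : ℕ) : ℕ∞)) : b f = 0 := by
  refine translation_contact_eq_zero_sigma_free p hd1 hn hnp hκf hrf hrκ hord ho ha hin hb ?_
  rw [ho']
  exact_mod_cast (by omega : r.degree + 1 ≤ p + n)


/-! ## §1 Readings of the twin-slot frame and their transport by a pure slot step -/

omit [DecidableEq K] in
/-- In a straight state of order `p + n` with `x^r ∣ F`, `|r| + d = p + n`, `r_f = 0`, every monomial of `x_f`-degree `≤ d − 1` has degree
`≥ p + n + 1` (the initial monomials are `x^r·x_f^d` only). [OURS · bookkeeping] -/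
theorem degree_succ_le_of_straight_sigma0 {p n d : ℕ} (hd1 : 1 ≤ d) {f : Fin 4} {B : State K}
    (hoB : ordZero B.F = ((p + n : ℕ) : ℕ∞)) (hrdeg : B.r.degree + d = p + n) (hBf : B.r f = 0)
    (hdivB : ∀ e ∈ B.F.support, B.r ≤ e)
    (hstraightB : ∀ m : Fin 4 →₀ ℕ, m.degree = d → m ≠ Finsupp.single f d → coeff (B.r + m) B.F = 0) :
    ∀ e ∈ B.F.support, e f ≤ d - 1 → p + n + 1 ≤ e.degree := by
  intro e he hef
  by_contra hlt
  have hcoef := MvPolynomial.mem_support_iff.mp he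
  rcases Nat.lt_or_ge e.degree (p + n) with h | h
  · exact hcoef (coeff_eq_zero_of_degree_lt_ordZero (by rw [hoB]; exact_mod_cast h))
  · have heq : e.degree = p + n := by omega
    obtain ⟨m, rfl⟩ : ∃ m, e = B.r + m := ⟨e - B.r, (add_tsub_cancel_of_le (hdivB e he)).symm⟩
    have hm : m.degree = d := by rw [map_add] at heq; omega
    have hne : m ≠ Finsupp.single f d := by
      intro hm'; rw [hm', Finsupp.add_apply, hBf, Finsupp.single_eq_same] at hef; omega
    exact hcoef (hstraightB m hm hne)

omit [DecidableEq K] in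
/-- The Tschirnhaus row vanishes by the slot ledger: `coeff (r + (d−1)·f + 2·λ) F = 0` (its `μ`-exponent is `n < n + 1`). [OURS ·
bookkeeping] -/
theorem tsch_row_of_ledger_sigma0 {n d : ℕ} {la mu f : Fin 4} (hlm : la ≠ mu) (hlf : la ≠ f) (hmf : mu ≠ f)
    {B : State K} (hBmu : B.r mu = n) (hBf : B.r f = 0)
    (hledB : ∀ e ∈ B.F.support, e f ≤ d - 1 → n + 1 ≤ e la ∧ n + 1 ≤ e mu) :
    coeff (B.r + (Finsupp.single f (d - 1) + Finsupp.single la 2)) B.F = 0 := by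
  by_contra hne
  have h := hledB _ (MvPolynomial.mem_support_iff.mpr hne) (by
    rw [Finsupp.add_apply, Finsupp.add_apply, hBf, Finsupp.single_eq_same, Finsupp.single_eq_of_ne hlf.symm]; omega)
  have h2 := h.2
  rw [Finsupp.add_apply, Finsupp.add_apply, hBmu, Finsupp.single_eq_of_ne hmf, Finsupp.single_eq_of_ne hlm.symm] at h2
  omega

/-- **The dead row passes to the pure slot child below `N − d`** (res-dim4-p-3's `row_step_zero_prime` with `1 ↦ n`): chart `j`, other
slot `i` of weight `≥ n` on the support, `n + d = p`. [OURS] [cite: Hauser2010, §§F–G] -/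
theorem row_step_zero_sigma0 (p : ℕ) {n d : ℕ} (hσ : n + d = p) {j i u f : Fin 4} (hji : j ≠ i) (hju : j ≠ u) (hjf : j ≠ f)
    (hiu : i ≠ u) (hif : i ≠ f) (huf : u ≠ f) (s : State K) (hin : ∀ e ∈ s.F.support, n ≤ e i)
    (hp : ∀ e ∈ s.F.support, p ≤ e.degree) {N eu ef : ℕ}
    (hrow : ∀ e ∈ s.F.support, e.degree < N → ¬ (e u = eu ∧ e f = ef)) :
    ∀ e' ∈ (CentreBlowup.step p Finset.univ j 0 s).F.support, e'.degree < N - d → ¬ (e' u = eu ∧ e' f = ef) := by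
  intro e' he' hN'
  obtain ⟨e, he, heE⟩ := ResCone.exists_of_mem_support_step_zero j s he'
  subst heE
  rw [chartExponent_apply_of_ne p Finset.univ hjf.symm, chartExponent_apply_of_ne p Finset.univ hju.symm]
  have hdeg := ResCone.degree_eq_quad hji hju hjf hiu hif huf e
  have hdeg' := ResCone.degree_eq_quad hji hju hjf hiu hif huf (chartExponent p Finset.univ j e)
  rw [ResCone.chartExponent_univ_apply_self, chartExponent_apply_of_ne p Finset.univ hji.symm,
    chartExponent_apply_of_ne p Finset.univ hju.symm, chartExponent_apply_of_ne p Finset.univ hjf.symm] at hdeg'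
  have := hin e he
  have := hp e he
  exact hrow e he (by omega)

/-- **THE ROW-FLAG COEFFICIENT IS CARRIED** (`n + d = p`, `eu + ef = d − 2`): for the twin weights `r = n·λ + n·μ`, `ord₀ F = p + n` and a
slot chart `j ∈ {λ, μ}`, the coefficient of `x^r · x_λ x_μ u^{eu+1} f^{ef}` is the SAME at the pure child: this exponent (degree
`p + n + 1`, `j`-exponent `n + 1`) is fixed by the chart law and is no `p`-th power (`u`-exponent `eu + 1 ≤ d − 1 < p`). [OURS]
[cite: Hauser2010, §§F–G] -/
theorem coeff_rowFlag_step_zero_sigma0 (p : ℕ) {n d : ℕ} (hσ : n + d = p) (hd2 : 2 ≤ d) {eu ef : ℕ} (hef : eu + ef = d - 2)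
    {lam mu u f j : Fin 4} (hlm : lam ≠ mu) (hlu : lam ≠ u) (hlf : lam ≠ f) (hmu : mu ≠ u) (hmf : mu ≠ f) (huf : u ≠ f)
    (hj : j = lam ∨ j = mu) {s : State K} (hr : s.r = Finsupp.single lam n + Finsupp.single mu n)
    (ho : ordZero s.F = ((p + n : ℕ) : ℕ∞)) :
    coeff (s.r + (Finsupp.single lam 1 + Finsupp.single mu 1 + Finsupp.single u (eu + 1) + Finsupp.single f ef))
        (CentreBlowup.step p Finset.univ j 0 s).F =
      coeff (s.r + (Finsupp.single lam 1 + Finsupp.single mu 1 + Finsupp.single u (eu + 1) + Finsupp.single f ef)) s.F := by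
  have hq : ((p : ℕ) : ℕ∞) ≤ ordAlong Finset.univ s.F := by
    rw [ordAlong_univ, ho]; exact_mod_cast (by omega : p ≤ p + n)
  have hdeg : (s.r + (Finsupp.single lam 1 + Finsupp.single mu 1 + Finsupp.single u (eu + 1) + Finsupp.single f ef)).degree =
      p + n + 1 := by
    rw [hr]; simp only [map_add, Finsupp.degree_single]; omega
  have hej : ((s.r + (Finsupp.single lam 1 + Finsupp.single mu 1 + Finsupp.single u (eu + 1) + Finsupp.single f ef) :
      Fin 4 →₀ ℕ)) j = n + 1 := by
    rcases hj with rfl | rfl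
    · rw [hr]; simp [hlm.symm, hlu, hlf]
    · rw [hr]; simp [hlm, hmu, hmf]
  have heu : ((s.r + (Finsupp.single lam 1 + Finsupp.single mu 1 + Finsupp.single u (eu + 1) + Finsupp.single f ef) :
      Fin 4 →₀ ℕ)) u = eu + 1 := by
    rw [hr]; simp [hlu.symm, hmu.symm, huf]
  have hce : chartExponent p Finset.univ j
      (s.r + (Finsupp.single lam 1 + Finsupp.single mu 1 + Finsupp.single u (eu + 1) + Finsupp.single f ef)) =
      s.r + (Finsupp.single lam 1 + Finsupp.single mu 1 + Finsupp.single u (eu + 1) + Finsupp.single f ef) := by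
    rw [chartExponent, degIn_univ, hdeg, show p + n + 1 - p = n + 1 by omega, ← hej, Finsupp.update_self]
  have h := ResCone.coeff_step_zero_chartExponent p j s hq
    (e := s.r + (Finsupp.single lam 1 + Finsupp.single mu 1 + Finsupp.single u (eu + 1) + Finsupp.single f ef))
    (by rw [hdeg]; omega)
  rw [hce, if_neg (ResCone.not_isPthPowerExponent_of_not_dvd (i := u) (by
    rw [heu]; intro hdvd; have := Nat.le_of_dvd (by omega) hdvd; omega))] at h
  exact h

/-! ## §2 The virtual translation vanishes in the frame ((VT-f) by W2σ, (VT-u) BY VALUE) -/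

omit [DecidableEq K] in
/-- **(VT) in the twin-slot frame, every σ = (n, n) + 0.**  In a state with weights `n·x_λ + n·x_μ`, order `p + n` (`n + d = p`),
`x^r ∣ F` and residual `a·x_f^d`, a `Step p` in the chart of `λ` with translation `b′` off the slots whose child has order `p + n` and
`e_G = 3` has `b′ = 0`: the `f`-component by σ-(VT-f), the `u`-component by the two-state pinning `hVTu` (BY VALUE; P1 supplies it).
[OURS] [cite: CossartJannsenSaito2020, Thm. 3.14] -/
theorem translation_eq_zero_of_frame_sigma0 [DecidableEq K] (p : ℕ) {n d : ℕ} (hσ : n + d = p) (hn : 0 < n) (hd1 : 1 ≤ d)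
    {la mu u f : Fin 4} (hlm : la ≠ mu) (hlu : la ≠ u) (hlf : la ≠ f) (hmu : mu ≠ u) (hmf : mu ≠ f) (huf : u ≠ f)
    {B : State K} (hoB : ordZero B.F = ((p + n : ℕ) : ℕ∞)) (hrB : B.r = Finsupp.single la n + Finsupp.single mu n)
    (hdivB : ∀ e ∈ B.F.support, B.r ≤ e) {a : K} (ha : a ≠ 0) (hformB : ResCone.resForm B = C a * X f ^ d)
    {b' : Fin 4 → K} (hb'la : b' la = 0) (hb'mu : b' mu = 0)
    (hoBp : ordZero (CentreBlowup.step p Finset.univ la b' B).F = ((p + n : ℕ) : ℕ∞))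
    (he3Bp : Module.finrank K (ResCone.resVertex (CentreBlowup.step p Finset.univ la b' B)) = 3)
    (hVTu : ∀ β : K, ordZero (CentreBlowup.step p Finset.univ la (Pi.single u β) B).F = ((p + n : ℕ) : ℕ∞) →
      Module.finrank K (ResCone.resVertex (CentreBlowup.step p Finset.univ la (Pi.single u β) B)) = 3 → β = 0) :
    b' = 0 := by
  classical
  have hin : initialForm B.F = monomial (B.r + Finsupp.single f d) a := initialForm_eq_of_resForm_sigma hdivB hformB
  have hBla : B.r la = n := by rw [hrB, Finsupp.add_apply, Finsupp.single_eq_same, Finsupp.single_eq_of_ne hlm, add_zero]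
  have hBmu : B.r mu = n := by rw [hrB, Finsupp.add_apply, Finsupp.single_eq_of_ne hlm.symm, Finsupp.single_eq_same, zero_add]
  have hBu : B.r u = 0 := by
    rw [hrB, Finsupp.add_apply, Finsupp.single_eq_of_ne hlu.symm, Finsupp.single_eq_of_ne hmu.symm, add_zero]
  have hBf : B.r f = 0 := by
    rw [hrB, Finsupp.add_apply, Finsupp.single_eq_of_ne hlf.symm, Finsupp.single_eq_of_ne hmf.symm, add_zero]
  have hrdeg : B.r.degree + d = p + n := by rw [hrB, map_add, Finsupp.degree_single, Finsupp.degree_single]; omega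
  have hb : ∀ i, B.r i ≠ 0 → b' i = 0 := by
    intro i hi
    rcases ResCone.letters_exhaust hlm hlu hlf hmu hmf huf i with h | h | h | h
    · rw [h]; exact hb'la
    · rw [h]; exact hb'mu
    · rw [h, hBu] at hi; exact absurd rfl hi
    · rw [h, hBf] at hi; exact absurd rfl hi
  have hb'f : b' f = 0 :=
    translation_contact_eq_zero_sigma_free_of_eq p hd1 hn (by omega) hlf hBf hBla hrdeg hoB ha hin hb hoBp
  have hb'eq : b' = Pi.single u (b' u) := eq_single_of_letters hlm hlu hlf hmu hmf huf hb'la hb'mu hb'f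
  have hb'u : b' u = 0 := by
    refine hVTu (b' u) ?_ ?_
    · rw [← hb'eq]; exact hoBp
    · rw [← hb'eq]; exact he3Bp
  rw [hb'eq, hb'u, Pi.single_zero]

/-! ## §3 The frame survives a pure slot step, every σ = (n, n) + 0 -/

/-- **FRAME PROPAGATION, every σ = (n, n) + 0.**  The frame at jet `N` (twin weights, `x^r ∣ F`, residual `a·x_f^d`, slot ledger, dead
`(u,f)`-row `(eu, ef)` below `N`, flag `coeff (r + λ + μ + (eu+1)u + ef·f) ≠ 0`) passes to the PURE slot child in the chart of `λ` at jet
`N − d`, given that the child has order `p + n` and `e_G = 3` (straightness of the child by res-dim4-p-7's (i)(ii) at `w = 0`; ledger by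
res-dim4-p-1's `ledger_step_zero_sigma`; row and flag by §1).  The `μ`-chart case is the same statement with `λ ↔ μ`. [OURS]
[cite: CossartJannsenSaito2020, Thm. 3.14, Lemma 13.2] -/
theorem frame_step_zero_sigma0 (p : ℕ) [Fact p.Prime] [CharP K p] {n d : ℕ} (hσ : n + d = p) (hn : 0 < n) (hd2 : 2 ≤ d)
    {la mu u f : Fin 4} (hlm : la ≠ mu) (hlu : la ≠ u) (hlf : la ≠ f) (hmu : mu ≠ u) (hmf : mu ≠ f) (huf : u ≠ f)
    {B : State K} (hoB : ordZero B.F = ((p + n : ℕ) : ℕ∞)) (hrB : B.r = Finsupp.single la n + Finsupp.single mu n)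
    (hdivB : ∀ e ∈ B.F.support, B.r ≤ e) {a : K} (ha : a ≠ 0) (hformB : ResCone.resForm B = C a * X f ^ d)
    (hledB : ∀ e ∈ B.F.support, e f ≤ d - 1 → n + 1 ≤ e la ∧ n + 1 ≤ e mu) {N eu ef : ℕ} (hef : eu + ef = d - 2)
    (hrowB : ∀ e ∈ B.F.support, e.degree < N → ¬ (e u = eu ∧ e f = ef))
    (hVB : coeff (B.r + (Finsupp.single la 1 + Finsupp.single mu 1 + Finsupp.single u (eu + 1) + Finsupp.single f ef)) B.F ≠ 0)
    (hoBp : ordZero (CentreBlowup.step p Finset.univ la 0 B).F = ((p + n : ℕ) : ℕ∞))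
    (he3Bp : Module.finrank K (ResCone.resVertex (CentreBlowup.step p Finset.univ la 0 B)) = 3) :
    (CentreBlowup.step p Finset.univ la 0 B).r = Finsupp.single la n + Finsupp.single mu n ∧
    (∀ e ∈ (CentreBlowup.step p Finset.univ la 0 B).F.support, (CentreBlowup.step p Finset.univ la 0 B).r ≤ e) ∧
    (∃ a' : K, a' ≠ 0 ∧ ResCone.resForm (CentreBlowup.step p Finset.univ la 0 B) = C a' * X f ^ d) ∧
    (∀ e ∈ (CentreBlowup.step p Finset.univ la 0 B).F.support, e f ≤ d - 1 → n + 1 ≤ e la ∧ n + 1 ≤ e mu) ∧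
    (∀ e ∈ (CentreBlowup.step p Finset.univ la 0 B).F.support, e.degree < N - d → ¬ (e u = eu ∧ e f = ef)) ∧
    coeff ((CentreBlowup.step p Finset.univ la 0 B).r +
        (Finsupp.single la 1 + Finsupp.single mu 1 + Finsupp.single u (eu + 1) + Finsupp.single f ef))
      (CentreBlowup.step p Finset.univ la 0 B).F ≠ 0 := by
  have hBla : B.r la = n := by rw [hrB, Finsupp.add_apply, Finsupp.single_eq_same, Finsupp.single_eq_of_ne hlm, add_zero]
  have hBmu : B.r mu = n := by rw [hrB, Finsupp.add_apply, Finsupp.single_eq_of_ne hlm.symm, Finsupp.single_eq_same, zero_add]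
  have hBf : B.r f = 0 := by
    rw [hrB, Finsupp.add_apply, Finsupp.single_eq_of_ne hlf.symm, Finsupp.single_eq_of_ne hmf.symm, add_zero]
  have hrdeg : B.r.degree + d = p + n := by rw [hrB, map_add, Finsupp.degree_single, Finsupp.degree_single]; omega
  -- weights and divisibility
  have hr' : (CentreBlowup.step p Finset.univ la 0 B).r = B.r := ResCone.step_zero_r_sigma p hoB hBla
  have hdivBp : ∀ e ∈ (CentreBlowup.step p Finset.univ la 0 B).F.support, (CentreBlowup.step p Finset.univ la 0 B).r ≤ e :=
    forall_le_step_gen (q := p) B hdivB la (b := (0 : Fin 4 → K)) rfl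
  -- straightness of the child, β (i)(ii) at `w = 0`
  obtain ⟨haB, hstraightB⟩ := readings_of_resForm_sigma hoB hrdeg hformB
  have htsch := tsch_row_of_ledger_sigma0 hlm hlf hmf hBmu hBf hledB
  have hrB0 : B.r = Finsupp.single la n + Finsupp.single mu n + Finsupp.single u 0 := by rw [hrB, Finsupp.single_zero, add_zero]
  obtain ⟨hstraight', hcarry, -⟩ := ResCone.twoSlot_legal_readings_of_corner_sigma p (show n + 0 + d = p by omega) hn hd2 hlm hlu hlf
    hmu hmf huf hrB0 hdivB hoB (by rw [haB]; exact ha) hstraightB htsch hoBp he3Bp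
  have hform' : ResCone.resForm (CentreBlowup.step p Finset.univ la 0 B) = C a * X f ^ d := by
    refine resForm_eq_of_readings_sigma hoBp (by rw [hr']; exact hrdeg) ?_ ?_
    · rw [hr', hcarry, haB]
    · intro m hm hne; rw [hr']; exact hstraight' m hm hne
  -- ledger, row and flag transport
  have h7 := degree_succ_le_of_straight_sigma0 (by omega : 1 ≤ d) hoB hrdeg hBf hdivB hstraightB
  have hled' := ResCone.ledger_step_zero_sigma hlm hlu hlf hmu hmf huf p (show n + 0 + d = p by omega) B (fun e _ => Nat.zero_le _)
    h7 hledB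
  have hin' : ∀ e ∈ B.F.support, n ≤ e mu := fun e he => by have h := hdivB e he mu; rwa [hBmu] at h
  have hpdeg : ∀ e ∈ B.F.support, p ≤ e.degree := fun e he => by
    by_contra hlt
    exact (MvPolynomial.mem_support_iff.mp he) (coeff_eq_zero_of_degree_lt_ordZero (by rw [hoB]; exact_mod_cast (by omega)))
  have hrow' := row_step_zero_sigma0 p hσ hlm hlu hlf hmu hmf huf B hin' hpdeg hrowB
  have hV' := coeff_rowFlag_step_zero_sigma0 p hσ hd2 hef hlm hlu hlf hmu hmf huf (Or.inl rfl) hrB hoB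
  refine ⟨by rw [hr', hrB], hdivBp, ⟨a, ha, hform'⟩, hled', hrow', ?_⟩
  rw [hr', hV']
  exact hVB

end SwapTransport

end Summit.ResolutionOfSingularities.ResolutionOfSingularities.Theorems.PIDim4

end
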